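import Summits.QuantumFields.BalabanUV.T4Continuum.Support.NE7K1LinWalkLine

/-!
# NE7K1LinWalkLineEntries — row NE7 (node U5), candidate route HOM, path H1L, cell K1-lin(s): THE ENTRIES OF RUN B THAT TOUCH A
# FLUCTUATION COORDINATE — the averaging part of `P_f` does not see them, the Laplacian part is `O((nL)²∕L^{d+1})` and couples
# ADJACENT coarse sites only (plus: a sparse matrix with small entries is small in `ℓ²`)

Lineage `b2b-balaban-t4-ne7-p2` (CRUX PROVER NE7 #2), generation 69; series (RW) file 11, over `NE7K1LinWalkLine` (g68, file 9: the
ψ-rescaled extended operator `𝒫♮(s)`, `comm_extLine`) toward the (H-comm) ESTIMATE for `𝒫♮(s)` (files 12–13) and the two-cutoff line's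
s-uniform walk expansion.  `H_B = runB = L^{−(d+1)}TᵀP_fT` (`NE7K1LinSchurLineU1.runB`, `T = NE7K1LinBlockCoords.coordT`,
`P_f = fineOpR (nL) a 0 R′`); a coordinate label is a coarse site `inl b` or a fluctuation label `inr (b,j)`, `j ≠ 0`.

* §1 `mulVec_sq_le_of_sparse` — **a sparse rectangular matrix with small entries is small**: `|M_{ik}| ≤ θ`, `M_{ik} ≠ 0 ⇒ rel i k`,
  at most `D₁` related `k` per `i` and `D₂` related `i` per `k` ⇒ `‖Mv‖² ≤ θ²D₁D₂‖v‖²` (Cauchy–Schwarz per row, double counting).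
* §2 the entries of `T` (`coordT_apply_inl∕inr`, `|T| ≤ 1`, a fluctuation column has two unit entries: `sum_abs_coordT_inr_le`), block
  labels of neighbours (`blk_eq_or_mem_nbrs_of_mem_nbrs`), the column `ℓ¹`-norm of the fine Laplacian (`sum_abs_lap_le`), the
  `nL`-block label is constant on an `L`-block (`rblk_mul_rchart_eq`).
* §3 **`runB_inr_eq_lap`**: against a fluctuation column the averaging part of `P_f` VANISHES (the `nL`-block indicator is constant on
  the `L`-block, the fluctuation column sums to zero), so `H_B(c, inr q) = L^{−(d+1)}(Tᵀ·lap·T)(c, inr q)`; **`abs_runB_inr_le`**: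
  `|H_B(c, inr q)| ≤ 8(d+1)(nL)²∕L^{d+1}`; **`mem_nbrs_of_runB_inr_ne_zero`**: `H_B(c, inr q) ≠ 0`, `site c ≠ q.1` ⇒ `q.1 ∼ site c`; the
  transposed versions by the symmetry of `H_B`.  (The three off-diagonal blocks of `[diag(λ∘site), H_B]` are bounded in file 12.)

HONEST FRAMING: [folklore] finite sums at the Gaussian `A = 0` level; crude constants (no face combinatorics: a fluctuation column of `T`
has two unit entries, a Laplacian column has `ℓ¹`-norm `≤ 4(d+1)(nL)²`); nothing of Bałaban's asserted; no `sorry`.  Census only (a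
helper toward the LINE's walk expansion); NO letter ∕ tag ∕ size of NE7 moves; NE7 NOT PRINTED ∕ NOT PROVED; spine 0∕9; FIXED FINITE T⁴,
rung (B)+1; NOT infinite volume, NOT mass gap, NOT Clay.  HONEST DEPENDENCY: continuum YM on T⁴ ⇐ BetaPertH ∧ nine spine estimates (0/9
proved); BetaPertH ⇐ (D1) ∧ (D4) ∧ CAP+tail; G-an2-4 gates asym, D1 and NE2/3/4.
-/

noncomputable section

open Finset Matrix

namespace Summit.QuantumFields.BalabanUV.T4Continuum.NE7K1LinWalkLineEntries

open Literature.MathematicalPhysics.QuantumFieldTheory.Balaban1983to89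
open Literature.MathematicalPhysics.QuantumFieldTheory.Balaban1983to89.B4Reflection242
open Literature.MathematicalPhysics.QuantumFieldTheory.Balaban1983to89.B4BoxCov237
open Literature.MathematicalPhysics.QuantumFieldTheory.Balaban1983to89.B4Lower18
open Literature.MathematicalPhysics.QuantumFieldTheory.Balaban1983to89.B4Thm110ZeroBox (blk_blk)
open Literature.MathematicalPhysics.QuantumFieldTheory.Balaban1983to89.B4Green244 (finePt)
open Literature.MathematicalPhysics.QuantumFieldTheory.Balaban1983to89.Beta.CombesThomasForm (lap lap_apply)
open NE7K1LinSchurLineCoords NE7K1LinBlockCoords NE7K1LinSchurLineU1 NE7K1LinSchurLineU1Sharp NE7K1LinTwoRunKit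
  NE7K1LinTwoRunUpper NE7K1LinWalkParametrix NE7K1LinWalkLine

variable {d : ℕ}

/-! ### §1 A sparse matrix with small entries is small in `ℓ²` -/

section Sparse

variable {ι κ : Type*} [Fintype ι] [Fintype κ]

/-- **SPARSE + SMALL ⇒ SMALL**: if `|M_{ik}| ≤ θ`, every nonzero entry is `rel`-related, each row has at most `D₁` related columns and
each column at most `D₂` related rows, then `‖Mv‖² ≤ θ²·D₁·D₂·‖v‖²`. [folklore] -/
theorem mulVec_sq_le_of_sparse (M : Matrix ι κ ℝ) (rel : ι → κ → Prop) [∀ i k, Decidable (rel i k)] {θ : ℝ}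
    (hM : ∀ i k, |M i k| ≤ θ) (hrel : ∀ i k, M i k ≠ 0 → rel i k) {D₁ D₂ : ℝ} (hD₁0 : 0 ≤ D₁)
    (hD₁ : ∀ i, ((univ.filter fun k => rel i k).card : ℝ) ≤ D₁) (hD₂ : ∀ k, ((univ.filter fun i => rel i k).card : ℝ) ≤ D₂)
    (v : κ → ℝ) : M *ᵥ v ⬝ᵥ M *ᵥ v ≤ θ ^ 2 * D₁ * D₂ * (v ⬝ᵥ v) := by
  classical
  have hrow : ∀ i, (M *ᵥ v) i = ∑ k ∈ univ.filter (fun k => rel i k), M i k * v k := by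
    intro i
    rw [mulVec, dotProduct, Finset.sum_filter]
    refine Finset.sum_congr rfl fun k _ => ?_
    by_cases h : rel i k
    · rw [if_pos h]
    · rw [if_neg h]
      have : M i k = 0 := by
        by_contra hne
        exact h (hrel i k hne)
      rw [this, zero_mul]
  have hsq : ∀ i, (M *ᵥ v) i ^ 2 ≤ θ ^ 2 * D₁ * ∑ k ∈ univ.filter (fun k => rel i k), v k ^ 2 := by
    intro i
    rw [hrow i]
    have hcs := Finset.sum_mul_sq_le_sq_mul_sq (univ.filter fun k => rel i k) (fun k => M i k) (fun k => v k)
    have h1 : ∑ k ∈ univ.filter (fun k => rel i k), M i k ^ 2 ≤ θ ^ 2 * ((univ.filter fun k => rel i k).card : ℝ) := by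
      have : ∀ k ∈ univ.filter (fun k => rel i k), M i k ^ 2 ≤ θ ^ 2 := fun k _ => by
        rw [← sq_abs]
        exact pow_le_pow_left₀ (abs_nonneg _) (hM i k) 2
      refine (Finset.sum_le_sum this).trans ?_
      rw [Finset.sum_const, nsmul_eq_mul, mul_comm]
    have h2 : 0 ≤ ∑ k ∈ univ.filter (fun k => rel i k), v k ^ 2 := Finset.sum_nonneg fun k _ => sq_nonneg _
    calc (∑ k ∈ univ.filter (fun k => rel i k), M i k * v k) ^ 2
        ≤ (∑ k ∈ univ.filter (fun k => rel i k), M i k ^ 2) * ∑ k ∈ univ.filter (fun k => rel i k), v k ^ 2 := hcs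
      _ ≤ θ ^ 2 * ((univ.filter fun k => rel i k).card : ℝ) * ∑ k ∈ univ.filter (fun k => rel i k), v k ^ 2 :=
          mul_le_mul_of_nonneg_right h1 h2
      _ ≤ θ ^ 2 * D₁ * ∑ k ∈ univ.filter (fun k => rel i k), v k ^ 2 :=
          mul_le_mul_of_nonneg_right (mul_le_mul_of_nonneg_left (hD₁ i) (sq_nonneg _)) h2
  have hswap : ∑ i, ∑ k ∈ univ.filter (fun k => rel i k), v k ^ 2 = ∑ k, ((univ.filter fun i => rel i k).card : ℝ) * v k ^ 2 := by
    have : ∀ i, ∑ k ∈ univ.filter (fun k => rel i k), v k ^ 2 = ∑ k, if rel i k then v k ^ 2 else 0 := fun i => by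
      rw [Finset.sum_filter]
    simp_rw [this]
    rw [Finset.sum_comm]
    refine Finset.sum_congr rfl fun k _ => ?_
    rw [← Finset.sum_filter, Finset.sum_const, nsmul_eq_mul]
  calc M *ᵥ v ⬝ᵥ M *ᵥ v = ∑ i, (M *ᵥ v) i ^ 2 := by simp only [dotProduct, sq]
    _ ≤ ∑ i, θ ^ 2 * D₁ * ∑ k ∈ univ.filter (fun k => rel i k), v k ^ 2 := Finset.sum_le_sum fun i _ => hsq i
    _ = θ ^ 2 * D₁ * ∑ k, ((univ.filter fun i => rel i k).card : ℝ) * v k ^ 2 := by rw [← Finset.mul_sum, hswap]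
    _ ≤ θ ^ 2 * D₁ * ∑ k, D₂ * v k ^ 2 := by
        refine mul_le_mul_of_nonneg_left (Finset.sum_le_sum fun k _ => ?_) (by positivity)
        exact mul_le_mul_of_nonneg_right (hD₂ k) (sq_nonneg _)
    _ = θ ^ 2 * D₁ * D₂ * (v ⬝ᵥ v) := by
        rw [← Finset.mul_sum]
        simp only [dotProduct, sq]
        ring

end Sparse

/-! ### §2 Entries of the coordinate matrix, block labels of neighbours, the Laplacian's column norm -/

section Coords

variable {n L : ℕ} [NeZero L] {R' : Finset (Fin (d + 1) → ℤ)} (hR'L : IsBlockUnion L R')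

/-- the coarse column of `T`: the indicator of the block. [folklore] -/
theorem coordT_apply_inl (x' : ↥R') (b : ↥(R'.image (blk L))) :
    coordT hR'L x' (Sum.inl b) = if rblk L R' x' = b then 1 else 0 := rfl

/-- the fluctuation column of `T`: `δ_{x′, Lb+j} − δ_{x′, Lb}`. [folklore] -/
theorem coordT_apply_inr (x' : ↥R') (q : ↥(R'.image (blk L)) × NZ d L) :
    coordT hR'L x' (Sum.inr q) = (if x' = rchart NeZero.one_le hR'L q.1 q.2.1 then (1 : ℝ) else 0) -
      (if x' = rchart NeZero.one_le hR'L q.1 0 then (1 : ℝ) else 0) := rfl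

/-- `|T_{x′c}| ≤ 1`. [folklore] -/
theorem abs_coordT_le_one (x' : ↥R') (c : Idx L R') : |coordT hR'L x' c| ≤ 1 := by
  rcases c with b | q
  · rw [coordT_apply_inl]
    split_ifs <;> norm_num
  · rw [coordT_apply_inr]
    split_ifs <;> norm_num

/-- a fluctuation column of `T` has `ℓ¹`-norm `≤ 2`. [folklore] -/
theorem sum_abs_coordT_inr_le (q : ↥(R'.image (blk L)) × NZ d L) : ∑ y' : ↥R', |coordT hR'L y' (Sum.inr q)| ≤ 2 := by
  classical
  have h : ∀ y' : ↥R', |coordT hR'L y' (Sum.inr q)| ≤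
      (if y' = rchart NeZero.one_le hR'L q.1 q.2.1 then (1 : ℝ) else 0) + (if y' = rchart NeZero.one_le hR'L q.1 0 then (1 : ℝ) else 0) := by
    intro y'
    rw [coordT_apply_inr]
    split_ifs <;> norm_num
  refine (Finset.sum_le_sum fun y' _ => h y').trans ?_
  rw [Finset.sum_add_distrib, Finset.sum_ite_eq', Finset.sum_ite_eq']
  simp only [Finset.mem_univ, if_true]
  norm_num

/-- a fluctuation column of `T` sums to zero. [folklore] -/
theorem sum_coordT_inr (q : ↥(R'.image (blk L)) × NZ d L) : ∑ y' : ↥R', coordT hR'L y' (Sum.inr q) = 0 := by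
  classical
  simp only [coordT_apply_inr, Finset.sum_sub_distrib, Finset.sum_ite_eq', Finset.mem_univ, if_true, sub_self]

/-- against a function of the `L`-block, a fluctuation column of `T` integrates to zero. [folklore] -/
theorem sum_blockFn_mul_coordT_inr (F : ↥(R'.image (blk L)) → ℝ) (q : ↥(R'.image (blk L)) × NZ d L) :
    ∑ y' : ↥R', F (rblk L R' y') * coordT hR'L y' (Sum.inr q) = 0 := by
  classical
  simp only [coordT_apply_inr, mul_sub, mul_ite, mul_one, mul_zero, Finset.sum_sub_distrib, Finset.sum_ite_eq',
    Finset.mem_univ, if_true, rblk_rchart, sub_self]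

omit [NeZero L] in
/-- **BLOCK LABELS OF NEIGHBOURS**: if `y ∼ x` on the fine lattice then `blk L y = blk L x` or `blk L y ∼ blk L x` (`L ≥ 1`). [folklore] -/
theorem blk_eq_or_mem_nbrs_of_mem_nbrs (hL : 1 ≤ L) {x y : Fin (d + 1) → ℤ} (h : y ∈ nbrs x) :
    blk L y = blk L x ∨ blk L y ∈ nbrs (blk L x) := by
  obtain ⟨i, hi⟩ := mem_nbrs.1 h
  -- the coordinates `k ≠ i` agree
  have hk : ∀ k, k ≠ i → blk L y k = blk L x k := by
    intro k hki
    rcases hi with rfl | rfl <;> simp [blk, hki]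
  -- the coordinate `i` moves by at most one
  have hci : |blk L y i - blk L x i| ≤ 1 := by
    have hxy : |y i - x i| ≤ 1 := by
      rcases hi with rfl | rfl <;> simp
    simpa [blk] using abs_ediv_sub_ediv_le_one hL hxy
  set c : ℤ := blk L y i - blk L x i with hc
  have hkey : blk L y = blk L x + c • Pi.single i (1 : ℤ) := by
    funext k
    by_cases hki : k = i
    · subst hki; simp [hc]
    · simp [hki, hk k hki]
  rcases Int.abs_le_one_iff.mp hci with h0 | h1 | hm1
  · left
    rw [hkey, h0, zero_smul, add_zero]
  · right
    rw [hkey, h1, one_smul]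
    exact mem_nbrs.2 ⟨i, Or.inl rfl⟩
  · right
    rw [hkey, hm1, neg_smul, one_smul, ← sub_eq_add_neg]
    exact mem_nbrs.2 ⟨i, Or.inr rfl⟩

omit [NeZero L] in
/-- **THE COLUMN `ℓ¹`-NORM OF THE FINE LAPLACIAN**: `Σ_{x′}|lap(adjC m R′)_{x′y′}| ≤ 4(d+1)m²` (diagonal = in-region degree `≤ 2(d+1)m²`,
off-diagonal row sum the same). [folklore] -/
theorem sum_abs_lap_le (m : ℕ) (R : Finset (Fin (d + 1) → ℤ)) (y : ↥R) :
    ∑ x : ↥R, |lap (adjC m R) x y| ≤ 4 * ((d : ℝ) + 1) * (m : ℝ) ^ 2 := by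
  classical
  have hdeg : ∀ z : ↥R, ∑ l : ↥R, adjC m R z l ≤ 2 * ((d : ℝ) + 1) * (m : ℝ) ^ 2 := by
    intro z
    rw [sum_adjC_eq]
    have h3 : (((nbrs z.1).filter fun w => w ∈ R).card : ℝ) ≤ 2 * ((d : ℝ) + 1) := by
      have := (Finset.card_filter_le (nbrs z.1) (fun w => w ∈ R)).trans (card_nbrs z.1).le
      exact_mod_cast this
    nlinarith [sq_nonneg (m : ℝ)]
  have h1 : ∀ x : ↥R, |lap (adjC m R) x y| ≤ (if x = y then ∑ l, adjC m R x l else 0) + adjC m R y x := by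
    intro x
    rw [lap_apply, adjC_symm m R x y]
    refine (abs_sub _ _).trans ?_
    have ha : 0 ≤ adjC m R y x := adjC_nonneg m R y x
    split_ifs
    · rw [abs_of_nonneg (Finset.sum_nonneg fun l _ => adjC_nonneg m R x l), abs_of_nonneg ha]
    · rw [abs_zero, abs_of_nonneg ha]
  refine (Finset.sum_le_sum fun x _ => h1 x).trans ?_
  rw [Finset.sum_add_distrib, Finset.sum_ite_eq' univ y, if_pos (Finset.mem_univ _)]
  linarith [hdeg y]

/-- the `nL`-block label of a chart point depends on the `L`-block only. [folklore] -/
theorem rblk_mul_rchart_eq (b : ↥(R'.image (blk L))) (j j' : Fin (d + 1) → Fin L) :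
    rblk (n * L) R' (rchart NeZero.one_le hR'L b j) = rblk (n * L) R' (rchart NeZero.one_le hR'L b j') := by
  have hL : 1 ≤ L := NeZero.one_le
  apply Subtype.ext
  show blk (n * L) (finePt L b.1 j) = blk (n * L) (finePt L b.1 j')
  rw [Nat.mul_comm, ← blk_blk, ← blk_blk, blk_finePt hL, blk_finePt hL]

end Coords

/-! ### §3 Run B against a fluctuation coordinate: the averaging part vanishes, the Laplacian part is small and local -/

section RunB

variable {n L : ℕ} [NeZero L] {R' : Finset (Fin (d + 1) → ℤ)} (hn : 1 ≤ n) (hR' : IsBlockUnion (n * L) R') (a : ℝ)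

/-- the entries of `H_B` as a double sum through the fine lattice. [folklore] -/
theorem runB_apply (hR'L : IsBlockUnion L R') (c c' : Idx L R') :
    runB hR'L n a c c' = ((L : ℝ) ^ (d + 1))⁻¹ *
      ∑ y' : ↥R', (∑ x' : ↥R', coordT hR'L x' c * fineOpR (n * L) a 0 R' x' y') * coordT hR'L y' c' := by
  simp only [runB, Matrix.smul_apply, smul_eq_mul, Matrix.mul_apply, transpose_apply]

include hn hR' in
/-- **AGAINST A FLUCTUATION COLUMN THE AVERAGING PART VANISHES**: `H_B(c, inr q) = L^{−(d+1)}·Σ_{y′}(Σ_{x′}T_{x′c}·lap_{x′y′})·T_{y′,inr q}`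
(the `nL`-block indicator is constant on the `L`-block of `q`, against which the fluctuation column sums to zero). [folklore] -/
theorem runB_inr_eq_lap (c : Idx L R') (q : ↥(R'.image (blk L)) × NZ d L) :
    runB (isBlockUnion_fine hR') n a c (Sum.inr q) = ((L : ℝ) ^ (d + 1))⁻¹ *
      ∑ y' : ↥R', (∑ x' : ↥R', coordT (isBlockUnion_fine hR') x' c * lap (adjC (n * L) R') x' y') *
        coordT (isBlockUnion_fine hR') y' (Sum.inr q) := by
  classical
  have hR'L : IsBlockUnion L R' := isBlockUnion_fine hR'
  have hnL : 1 ≤ n * L := Nat.one_le_iff_ne_zero.2 (Nat.mul_ne_zero (Nat.one_le_iff_ne_zero.1 hn) (NeZero.ne L))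
  rw [runB_apply]
  congr 1
  -- split `P_f = lap + A` under the sums
  set A : ↥R' → ↥R' → ℝ := fun x' y' => ∑ B : ↥(R'.image (blk (n * L))),
    a / ((Finset.univ.filter fun i => rblk (n * L) R' i = B).card : ℝ) *
      ((if rblk (n * L) R' x' = B then (1 : ℝ) else 0) * (if rblk (n * L) R' y' = B then (1 : ℝ) else 0)) with hA
  have hsplit : ∀ x' y' : ↥R', fineOpR (n * L) a 0 R' x' y' = lap (adjC (n * L) R') x' y' + A x' y' := fun x' y' =>
    fineOpR_zero_eq hnL hR' a x' y'
  -- the `A`-part: a function of the `nL`-block of `y′`, against the fluctuation column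
  set G : ↥(R'.image (blk (n * L))) → ℝ := fun B' => ∑ x' : ↥R', coordT hR'L x' c *
    ∑ B : ↥(R'.image (blk (n * L))), a / ((Finset.univ.filter fun i => rblk (n * L) R' i = B).card : ℝ) *
      ((if rblk (n * L) R' x' = B then (1 : ℝ) else 0) * (if B' = B then (1 : ℝ) else 0)) with hG
  have hAG : ∀ y' : ↥R', ∑ x' : ↥R', coordT hR'L x' c * A x' y' = G (rblk (n * L) R' y') := fun y' => rfl
  have hzero : ∑ y' : ↥R', G (rblk (n * L) R' y') * coordT hR'L y' (Sum.inr q) = 0 := by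
    simp only [coordT_apply_inr, mul_sub, mul_ite, mul_one, mul_zero, Finset.sum_sub_distrib, Finset.sum_ite_eq',
      Finset.mem_univ, if_true, rblk_mul_rchart_eq hR'L q.1 q.2.1 0, sub_self]
  simp_rw [hsplit, mul_add, Finset.sum_add_distrib, add_mul]
  rw [Finset.sum_add_distrib]
  simp_rw [hAG]
  rw [hzero, add_zero]

include hn hR' in
/-- **THE ENTRY BOUND**: `|H_B(c, inr q)| ≤ 8(d+1)(nL)²∕L^{d+1}` for every coordinate `c` and fluctuation label `q` (two unit entries in
the column of `q`, Laplacian column norm `≤ 4(d+1)(nL)²`, `|T| ≤ 1`). [folklore] -/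
theorem abs_runB_inr_le (c : Idx L R') (q : ↥(R'.image (blk L)) × NZ d L) :
    |runB (isBlockUnion_fine hR') n a c (Sum.inr q)| ≤ 8 * ((d : ℝ) + 1) * ((n : ℝ) * L) ^ 2 / (L : ℝ) ^ (d + 1) := by
  have hR'L : IsBlockUnion L R' := isBlockUnion_fine hR'
  have hLpow : (0 : ℝ) < (L : ℝ) ^ (d + 1) := pow_pos (by exact_mod_cast (NeZero.one_le : 1 ≤ L)) _
  rw [runB_inr_eq_lap hn hR' a c q, abs_mul, abs_of_pos (inv_pos.2 hLpow), div_eq_mul_inv, mul_comm _ (((L : ℝ) ^ (d + 1))⁻¹)]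
  refine mul_le_mul_of_nonneg_left ?_ (inv_pos.2 hLpow).le
  -- `|Σ_{y′}(Σ_{x′}T lap)T| ≤ Σ_{y′}|T_{y′q}|·Σ_{x′}|lap_{x′y′}| ≤ 2·4(d+1)(nL)²`
  have hinner : ∀ y' : ↥R', |∑ x' : ↥R', coordT hR'L x' c * lap (adjC (n * L) R') x' y'| ≤ 4 * ((d : ℝ) + 1) * ((n : ℝ) * L) ^ 2 := by
    intro y'
    refine (Finset.abs_sum_le_sum_abs _ _).trans ?_
    have h1 : ∀ x' : ↥R', |coordT hR'L x' c * lap (adjC (n * L) R') x' y'| ≤ |lap (adjC (n * L) R') x' y'| := fun x' => by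
      rw [abs_mul]
      exact mul_le_of_le_one_left (abs_nonneg _) (abs_coordT_le_one hR'L x' c)
    refine (Finset.sum_le_sum fun x' _ => h1 x').trans ?_
    have := sum_abs_lap_le (n * L) R' y'
    push_cast at this
    exact this
  calc |∑ y' : ↥R', (∑ x' : ↥R', coordT hR'L x' c * lap (adjC (n * L) R') x' y') * coordT hR'L y' (Sum.inr q)|
      ≤ ∑ y' : ↥R', |(∑ x' : ↥R', coordT hR'L x' c * lap (adjC (n * L) R') x' y') * coordT hR'L y' (Sum.inr q)| :=
        Finset.abs_sum_le_sum_abs _ _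
    _ ≤ ∑ y' : ↥R', 4 * ((d : ℝ) + 1) * ((n : ℝ) * L) ^ 2 * |coordT hR'L y' (Sum.inr q)| := by
        refine Finset.sum_le_sum fun y' _ => ?_
        rw [abs_mul]
        exact mul_le_mul_of_nonneg_right (hinner y') (abs_nonneg _)
    _ ≤ 4 * ((d : ℝ) + 1) * ((n : ℝ) * L) ^ 2 * 2 := by
        rw [← Finset.mul_sum]
        exact mul_le_mul_of_nonneg_left (sum_abs_coordT_inr_le hR'L q) (by positivity)
    _ = 8 * ((d : ℝ) + 1) * ((n : ℝ) * L) ^ 2 := by ring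

include hn hR' in
/-- the transposed entry bound (`H_B` is symmetric). [folklore] -/
theorem abs_runB_inr_le' (q : ↥(R'.image (blk L)) × NZ d L) (c : Idx L R') :
    |runB (isBlockUnion_fine hR') n a (Sum.inr q) c| ≤ 8 * ((d : ℝ) + 1) * ((n : ℝ) * L) ^ 2 / (L : ℝ) ^ (d + 1) := by
  rw [(runB_isSymm (isBlockUnion_fine hR') n a).apply c (Sum.inr q)]
  exact abs_runB_inr_le hn hR' a c q

include hn hR' in
/-- **LOCALITY**: a nonzero entry `H_B(c, inr q)` with `site c ≠ q.1` forces the coarse sites to be NEIGHBOURS (the Laplacian couples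
fine neighbours, whose `L`-blocks coincide or are adjacent). [folklore] -/
theorem mem_nbrs_of_runB_inr_ne_zero {c : Idx L R'} {q : ↥(R'.image (blk L)) × NZ d L}
    (h : runB (isBlockUnion_fine hR') n a c (Sum.inr q) ≠ 0) (hne : site c ≠ q.1) : q.1.1 ∈ nbrs (site c).1 := by
  classical
  have hR'L : IsBlockUnion L R' := isBlockUnion_fine hR'
  have hL : 1 ≤ L := NeZero.one_le
  rw [runB_inr_eq_lap hn hR' a c q] at h
  have h1 := right_ne_zero_of_mul h
  obtain ⟨y', -, hy'⟩ := Finset.exists_ne_zero_of_sum_ne_zero h1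
  have hT' : coordT hR'L y' (Sum.inr q) ≠ 0 := right_ne_zero_of_mul hy'
  obtain ⟨x', -, hx'⟩ := Finset.exists_ne_zero_of_sum_ne_zero (left_ne_zero_of_mul hy')
  have hT : coordT hR'L x' c ≠ 0 := left_ne_zero_of_mul hx'
  have hlap : lap (adjC (n * L) R') x' y' ≠ 0 := right_ne_zero_of_mul hx'
  have hxc : rblk L R' x' = site c := coordT_compat hR'L x' c hT
  have hyq : rblk L R' y' = q.1 := coordT_compat hR'L y' (Sum.inr q) hT'
  -- `lap_{x′y′} ≠ 0` ⇒ `x′ = y′` or `y′ ∼ x′`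
  by_cases hxy : x' = y'
  · subst hxy
    exact absurd (hxc.symm.trans hyq) hne
  · have hadj : y'.1 ∈ nbrs x'.1 := by
      rw [lap_apply, if_neg hxy, zero_sub, neg_ne_zero] at hlap
      by_contra hn'
      exact hlap (if_neg hn')
    rcases blk_eq_or_mem_nbrs_of_mem_nbrs hL hadj with heq | hnb
    · exfalso
      apply hne
      rw [← hxc, ← hyq]
      exact Subtype.ext heq.symm
    · have e1 : (site c).1 = blk L x'.1 := by rw [← hxc]; rfl
      have e2 : q.1.1 = blk L y'.1 := by rw [← hyq]; rfl
      rw [e1, e2]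
      exact hnb

include hn hR' in
/-- the transposed locality statement. [folklore] -/
theorem mem_nbrs_of_runB_inr_ne_zero' {q : ↥(R'.image (blk L)) × NZ d L} {c : Idx L R'}
    (h : runB (isBlockUnion_fine hR') n a (Sum.inr q) c ≠ 0) (hne : q.1 ≠ site c) : (site c).1 ∈ nbrs q.1.1 := by
  rw [(runB_isSymm (isBlockUnion_fine hR') n a).apply c (Sum.inr q)] at h
  exact nbrs_comm.1 (mem_nbrs_of_runB_inr_ne_zero hn hR' a h hne.symm)

end RunB

end Summit.QuantumFields.BalabanUV.T4Continuum.NE7K1LinWalkLineEntries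

end
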